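import Summits.BirchSwinnertonDyer.BirchSwinnertonDyer.Theorems.CycTangentCMCycTangentBoundSplitPrimePowerLine
import HarnessLib

/-!
# The rational wall `RationalSplitIMCInclusionAtThree` (stmt-BirchSwinnertonDyer-24207), line `ratwall_thin_comb`, input (S) of stub 1:
# THE VERTICAL INTERPOLATION CHARACTER of a `𝔭`-adapted frame — powers of an everywhere-unramified type-`(k, 0)` character
# have `p`-adic avatars through the pair which are TRIVIAL AT `γ₂` and NON-TORSION OFF THE `γ₂`-LINE
# (`--supports stmt-BirchSwinnertonDyer-24207`; cell `pub/bsd-wall`, LEAD `cruxlead-24207` g33; nothing is closed; BSD is not proved)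

WHY. The v8.3 reading of the line `ratwall_thin_comb` (certificates `…ClosedModuloV83*.lean`) derives clause (ii) of the registered
stub `stub_toricExistsSymmUpTo2` from a normalised frame, Jacquet's functional equation (print, BY NAME) and ONE displayed input
(S): a FIBRED SUPPLY of interpolation characters through the pair in a `𝔭`-adapted frame (`κ₁` unramified outside `𝔭`) —
infinitely many inner values `y = r(γ₂) − 1`, over each infinitely many outer values `x = r(γ₁) − 1` (SUPPLY-GRID-utd-idea-g59 §2,
items S-a … S-d: «print + kernel, to do»). The fibration S-d rests on ONE arithmetic object, supplied here: a character through the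
pair that is EXACTLY `1` at `γ₂` and of infinite order at `γ₁` (and at every `σ` with `κ₁ σ ≠ 0`, e.g. `τ γ₂` for the frame
involution `τ`). Everything else of (S) is bookkeeping (next file).

WHAT IS PROVED (theorems only; every input a tree theorem).
* §1 `avatarValueAt_eq_one_of_inertia` — in a `𝔭`-adapted frame (`κ₁` kills the inertia above `v̄ ≠ v = 𝔭`), a rank-one `r`
  THROUGH THE PAIR, UNRAMIFIED AT `v̄`, with values in the one-units of level `|p|`, satisfies **`r(γ₂) = 1`**: Brink's ramification of
  the anticyclotomic tower gives `τ₀ ∈ I_𝔓`, `𝔓 ∣ v̄`, acting non-trivially on the tower (tree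
  `exists_mem_inertia_apply_ne_one_of_isAnticyclotomic` + `toAdd_eq_zero_of_isTopGeneratorPair`); `κ₁ τ₀ = 0`, so `κ₂ τ₀ = pᵉ·u ≠ 0`
  and `γ₂^{pᵉ}` has the coordinates `u⁻¹·(κ₁τ₀, κ₂τ₀)`; `r(τ₀) = 1` propagates along `ℤ_p·(κ₁τ₀, κ₂τ₀)` (tree
  `avatarValueAt_eq_one_of_pairMap_eq_mul`), so `r(γ₂)^{pᵉ} = 1`, and there is no `p`-power torsion among one-units of level `|p|`.
* §2 `avatarValueAt_eq_one_of_two` — a rank-one `r` through the pair with one-unit values of level `|p|` killing TWO elements whose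
  coordinate vectors have non-zero determinant is TRIVIAL (Cramer: `pᵉ·(κ₁g, κ₂g)` is a `ℤ_p`-combination of the two vectors).
* §3 **`exists_verticalCharacter`** — for `K` imaginary quadratic, `p` odd and split (`v ≠ v̄`, `ι` normalised by the frames' clause
  `hι`, = `BranchInducesPrime`), a generator pair with `κ₁` unramified outside `v`, and `Ψ` of type `(k, 0)`, `k > 0`, unramified
  everywhere: there are `M > 0` and a continuous `χ : Γ_K → ℚ̄_pˣ` with (a) `e ∘ χⁿ` the `p`-adic avatar of `Ψ^{Mn}`, through the
  pair, for every `n` (tree `exists_isPAdicAvatarOf_pow_factorsThroughPair`); (b) all values `r(σ)` of all `e ∘ χⁿ` in the one-units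
  of level `|p|`; (c) **`χ(γ₂) = 1`** (§1 with the tree's `isUnramifiedAt_avatar_of_hasInfinityType_zero`: the avatar of a type-`(k,0)`
  character is unramified at `v̄`); (d) **`χ(σ)ⁿ ≠ 1` for `n > 0` whenever `κ₁ σ ≠ 0`** (§2: else `e ∘ χⁿ` is trivial, so `Ψ^{Mn}`
  has the avatar of `1` and IS `1` — tree `eq_of_isPAdicAvatarOf_of_isPAdicAvatarOf` — contradicting its type `(kMn, 0) ≠ (0,0)`).
  With `Literature…HeckeCharacter.exists_hasInfinityType_pos_zero_unramified` (type `(h_K·w_K, 0)`, any class number) such a `Ψ`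
  exists on every imaginary quadratic field.

HONEST SCOPE: class-field-theoretic bookkeeping for the interpolation supply of a two-variable `p`-adic `L`-function; nothing here is
evidence that such a function exists at the additive split `3`; 24207 / 20395 / 20186 OPEN; BSD is proved for no curve.

References: [Weil1956] §1–§2; [SerreAbelianLadic1968] Ch. III §2.3; [Brink2007] Cor. 1; [Washington1997] §13.1, Thm. 13.4;
[deShalit1987] II.1.4 Lemma (ii), II.4.17; [BuyukbodukLei2017] Def. 3.8 (arXiv:1707.00557).
-/

set_option linter.dupNamespace false
set_option autoImplicit false

noncomputable section

open scoped NumberField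
open NumberField IsDedekindDomain Field
open Literature Literature.NumberTheory.GaloisRepresentations Literature.NumberTheory.EllipticCurves
open Summit.BirchSwinnertonDyer.Rank1Residual.X11b.Three.LambdaSupply
open Summit.BirchSwinnertonDyer.BirchSwinnertonDyer.Theorems.CycTangentCMCycTangentBoundPairSupply
open Summit.BirchSwinnertonDyer.BirchSwinnertonDyer.Theorems.CycTangentCMCycTangentBoundSplitPrimePowerLine

namespace Summit.BirchSwinnertonDyer.BirchSwinnertonDyer.Theorems.UniversalToricDescentThinComb.VerticalCharacter

variable {p : ℕ} [Fact p.Prime] {K : Type} [Field K] [NumberField K]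

/-! ### §1. In a `𝔭`-adapted frame, a character through the pair that is unramified at `v̄` is trivial at `γ₂` -/

/-- **`r(γ₂) = 1`** for a rank-one `r` through a generator pair `(κ₁, κ₂; γ₁, γ₂)` whose `κ₁` kills the inertia above `v̄`
(`v̄ ≠ v` the two places above the odd split `p` of the imaginary quadratic `K`), provided `r` is unramified at `v̄` and its values are
one-units of level `|p|`. [cite: Brink2007, Cor. 1] [cite: Washington1997, §13.1] -/
theorem avatarValueAt_eq_one_of_inertia (hK : IsImaginaryQuadratic K) (hp2 : p ≠ 2)
    {v vbar : HeightOneSpectrum (𝓞 K)} (hpvbar : ((p : ℕ) : 𝓞 K) ∈ vbar.asIdeal) (hne : vbar ≠ v)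
    {κ₁ κ₂ : ZpExtension K p} {γ₁ γ₂ : absoluteGaloisGroup K}
    (hpair : ZpExtension.IsTopGeneratorPair κ₁ κ₂ γ₁ γ₂)
    (hur₁ : ∀ w : HeightOneSpectrum (𝓞 K), w ≠ v → ∀ 𝔓 ∈ w.primesAbove,
      𝔓.inertia (absoluteGaloisGroup K) ≤ κ₁.kerSubgroup)
    {r : FramedGaloisRep K (PadicAlgCl p) 1} (hr : FactorsThroughPair κ₁ κ₂ r) (hrunr : r.IsUnramifiedAt vbar)
    (hsmall : ∀ σ : absoluteGaloisGroup K, ‖avatarValueAt r σ - 1‖ < ‖(p : ℂ_[p])‖) :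
    avatarValueAt r γ₂ = 1 := by
  have himag : ∀ w : InfinitePlace K, w.IsComplex := fun w ↦ hK.2.isComplex w
  obtain ⟨𝔓₀, h𝔓₀⟩ := vbar.primesAbove_nonempty
  -- an inertia element above `v̄` acting non-trivially on the tower
  obtain ⟨κa, hκa⟩ := ZpExtension.exists_isAnticyclotomic_holds (K := K) (p := p) hK.1 himag
  obtain ⟨τ₀, hτ₀, hτ₀ne⟩ :=
    ZpExtension.exists_mem_inertia_apply_ne_one_of_isAnticyclotomic hK hp2 κa hκa hpvbar h𝔓₀
  -- its coordinates: `κ₁ τ₀ = 0` (adapted frame), hence `t = κ₂ τ₀ ≠ 0`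
  have h₁ : κ₁ τ₀ = 1 := hur₁ vbar hne 𝔓₀ h𝔓₀ hτ₀
  set t : ℤ_[p] := Multiplicative.toAdd (κ₂ τ₀) with ht_def
  have ht0 : t ≠ 0 := by
    intro ht0
    have h₂ : κ₂ τ₀ = 1 := by rw [← ofAdd_toAdd (κ₂ τ₀), ← ht_def, ht0, ofAdd_zero]
    have h3 := toAdd_eq_zero_of_isTopGeneratorPair hK.1 himag hpair κa.toContinuousMonoidHom h₁ h₂
    rw [ZpExtension.coe_toContinuousMonoidHom] at h3
    exact hτ₀ne h3
  -- `t = u · pᵉ`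
  set e : ℕ := t.valuation with he_def
  set u : ℤ_[p]ˣ := PadicInt.unitCoeff ht0 with hu_def
  have htu : t = (u : ℤ_[p]) * (p : ℤ_[p]) ^ e := PadicInt.unitCoeff_spec ht0
  -- `r(τ₀) = 1`
  have hr0 : avatarValueAt r τ₀ = 1 := by
    rw [avatarValueAt, hrunr 𝔓₀ h𝔓₀ τ₀ hτ₀]; simp
  -- `γ₂^{pᵉ}` has coordinates `u⁻¹ · (κ₁τ₀, κ₂τ₀) = (0, pᵉ)`
  have e12 : Multiplicative.toAdd (κ₁ γ₂) = 0 := by rw [hpair.apply_right]; rfl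
  have e22 : Multiplicative.toAdd (κ₂ γ₂) = 1 := by rw [hpair.right]; rfl
  have hpow1 : Multiplicative.toAdd (κ₁ (γ₂ ^ p ^ e)) = (↑u⁻¹ : ℤ_[p]) * Multiplicative.toAdd (κ₁ τ₀) := by
    rw [map_pow, toAdd_pow, e12, smul_zero, h₁]
    simp
  have hpow2 : Multiplicative.toAdd (κ₂ (γ₂ ^ p ^ e)) = (↑u⁻¹ : ℤ_[p]) * Multiplicative.toAdd (κ₂ τ₀) := by
    rw [map_pow, toAdd_pow, e22, nsmul_eq_mul, mul_one, ← ht_def, htu, ← mul_assoc, Units.inv_mul, one_mul]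
    push_cast
    ring
  have hval := avatarValueAt_eq_one_of_pairMap_eq_mul hpair hr hr0 (↑u⁻¹) (γ₂ ^ p ^ e) hpow1 hpow2
  rw [RamifiedSevenEllipticUnits.LemmaXi.avatarValueAt_pow] at hval
  exact avatarValueAt_torsionFree_of_norm_sub_one_lt hsmall γ₂ e hval

/-! ### §2. A character through the pair killing two independent elements is trivial -/

/-- **Two independent zeros kill a character through the pair.** If `r` (rank one, through the pair, one-unit values of level
`|p|`) has `r(σ₁) = r(σ₂) = 1` and the coordinate vectors `(κ₁σ₁, κ₂σ₁)`, `(κ₁σ₂, κ₂σ₂)` have non-zero determinant, then `r(g) = 1`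
for every `g`: `pᵉ·(κ₁g, κ₂g)` (`pᵉ` the exact power in the determinant) is a `ℤ_p`-combination of the two vectors (Cramer), so
`r(g)^{pᵉ} = 1`. [cite: Washington1997, §13.1 and Thm. 13.4] -/
theorem avatarValueAt_eq_one_of_two {κ₁ κ₂ : ZpExtension K p} {γ₁ γ₂ : absoluteGaloisGroup K}
    (hpair : ZpExtension.IsTopGeneratorPair κ₁ κ₂ γ₁ γ₂)
    {r : FramedGaloisRep K (PadicAlgCl p) 1} (hr : FactorsThroughPair κ₁ κ₂ r)
    (hsmall : ∀ σ : absoluteGaloisGroup K, ‖avatarValueAt r σ - 1‖ < ‖(p : ℂ_[p])‖)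
    {σ₁ σ₂ : absoluteGaloisGroup K} (h₁ : avatarValueAt r σ₁ = 1) (h₂ : avatarValueAt r σ₂ = 1)
    (hdet : Multiplicative.toAdd (κ₁ σ₁) * Multiplicative.toAdd (κ₂ σ₂) -
      Multiplicative.toAdd (κ₂ σ₁) * Multiplicative.toAdd (κ₁ σ₂) ≠ 0)
    (g : absoluteGaloisGroup K) : avatarValueAt r g = 1 := by
  set a := Multiplicative.toAdd (κ₁ σ₁) with ha
  set b := Multiplicative.toAdd (κ₂ σ₁) with hb
  set c := Multiplicative.toAdd (κ₁ σ₂) with hc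
  set d := Multiplicative.toAdd (κ₂ σ₂) with hd
  set D : ℤ_[p] := a * d - b * c with hD
  have hD0 : D ≠ 0 := hdet
  set E : ℕ := D.valuation with hE
  set w : ℤ_[p]ˣ := PadicInt.unitCoeff hD0 with hw
  have hDw : D = (w : ℤ_[p]) * (p : ℤ_[p]) ^ E := PadicInt.unitCoeff_spec hD0
  set x := Multiplicative.toAdd (κ₁ g) with hx
  set y := Multiplicative.toAdd (κ₂ g) with hy
  -- Cramer: `pᴱ (x, y) = μ (a, b) + ν (c, d)`
  set μ : ℤ_[p] := (↑w⁻¹ : ℤ_[p]) * (x * d - y * c) with hμ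
  set ν : ℤ_[p] := (↑w⁻¹ : ℤ_[p]) * (y * a - x * b) with hν
  have hwinv : (↑w⁻¹ : ℤ_[p]) * D = (p : ℤ_[p]) ^ E := by
    rw [hDw, ← mul_assoc, Units.inv_mul, one_mul]
  have hX : ((p : ℤ_[p]) ^ E) * x = μ * a + ν * c := by
    rw [← hwinv, hμ, hν, hD]; ring
  have hY : ((p : ℤ_[p]) ^ E) * y = μ * b + ν * d := by
    rw [← hwinv, hμ, hν, hD]; ring
  -- elements with coordinates `μ (a, b)` and `ν (c, d)`
  obtain ⟨s₁, hs₁⟩ := surjective_pairMap hpair (μ * a, μ * b)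
  obtain ⟨s₂, hs₂⟩ := surjective_pairMap hpair (ν * c, ν * d)
  simp only [Prod.mk.injEq] at hs₁ hs₂
  have hr₁ : avatarValueAt r s₁ = 1 := avatarValueAt_eq_one_of_pairMap_eq_mul hpair hr h₁ μ s₁ hs₁.1 hs₁.2
  have hr₂ : avatarValueAt r s₂ = 1 := avatarValueAt_eq_one_of_pairMap_eq_mul hpair hr h₂ ν s₂ hs₂.1 hs₂.2
  -- `g^{pᴱ} (s₁ s₂)⁻¹` lies in the pair kernel
  have hk₁ : κ₁ (g ^ p ^ E * (s₁ * s₂)⁻¹) = 1 := by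
    apply toAdd_eq_zero.mp
    rw [map_mul, map_inv, toAdd_mul, toAdd_inv, map_mul, toAdd_mul, map_pow, toAdd_pow, hs₁.1, hs₂.1, ← hx,
      nsmul_eq_mul]
    push_cast
    linear_combination hX
  have hk₂ : κ₂ (g ^ p ^ E * (s₁ * s₂)⁻¹) = 1 := by
    apply toAdd_eq_zero.mp
    rw [map_mul, map_inv, toAdd_mul, toAdd_inv, map_mul, toAdd_mul, map_pow, toAdd_pow, hs₁.2, hs₂.2, ← hy,
      nsmul_eq_mul]
    push_cast
    linear_combination hY
  have hker : avatarValueAt r (g ^ p ^ E * (s₁ * s₂)⁻¹) = 1 := by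
    rw [avatarValueAt, hr _ hk₁ hk₂]; simp
  have hpow : avatarValueAt r g ^ p ^ E = 1 := by
    have h : g ^ p ^ E = (g ^ p ^ E * (s₁ * s₂)⁻¹) * (s₁ * s₂) := by group
    rw [← RamifiedSevenEllipticUnits.LemmaXi.avatarValueAt_pow, h, avatarValueAt_mul, hker, avatarValueAt_mul, hr₁, hr₂,
      mul_one, mul_one]
  exact avatarValueAt_torsionFree_of_norm_sub_one_lt hsmall g E hpow

/-! ### §3. The vertical interpolation character -/

/-- **THE VERTICAL INTERPOLATION CHARACTER of a `𝔭`-adapted frame.** For `K` imaginary quadratic, `p` odd and split (`v̄ ≠ v`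
above `p`; `ι : ℚ̄_p ≃ ℂ` inducing `v` through every `w.embedding` — the frames' clause `hι`, `BranchInducesPrime`), a generator pair
`(κ₁, κ₂; γ₁, γ₂)` with `κ₁` unramified outside `v`, and an everywhere-unramified Hecke character `Ψ` of type `(k, 0)`, `k > 0`:
there are `M > 0` and a continuous `χ : Γ_K → ℚ̄_pˣ` such that (a) `e ∘ χⁿ` is the `p`-adic avatar of `Ψ^{Mn}` and factors through
the pair, for every `n`; (b) every value of every `e ∘ χⁿ` is a one-unit of level `|p|`; (c) `χ(γ₂) = 1`; (d) `χ(σ)ⁿ ≠ 1` for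
`n > 0` and every `σ` with `κ₁ σ ≠ 0`. [cite: Weil1956, §1–§2] [cite: SerreAbelianLadic1968, Ch. III §2.3] [cite: Brink2007, Cor. 1]
[cite: Washington1997, §13.1, Thm. 13.4] -/
theorem exists_verticalCharacter (ι : PadicAlgCl p ≃+* ℂ) (hK : IsImaginaryQuadratic K) (hp2 : p ≠ 2)
    {v vbar : HeightOneSpectrum (𝓞 K)} (hpvbar : ((p : ℕ) : 𝓞 K) ∈ vbar.asIdeal) (hne : vbar ≠ v)
    (hι : ∀ (w : InfinitePlace K) (d : 𝓞 K), d ∈ v.asIdeal ↔ ‖ι.symm (w.embedding (d : K))‖ < 1)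
    {κ₁ κ₂ : ZpExtension K p} {γ₁ γ₂ : absoluteGaloisGroup K}
    (hpair : ZpExtension.IsTopGeneratorPair κ₁ κ₂ γ₁ γ₂)
    (hur₁ : ∀ w : HeightOneSpectrum (𝓞 K), w ≠ v → ∀ 𝔓 ∈ w.primesAbove,
      𝔓.inertia (absoluteGaloisGroup K) ≤ κ₁.kerSubgroup)
    {Ψ : HeckeCharacter K} {k : ℕ} (hk : 0 < k) (hΨt : Ψ.HasInfinityType (fun _ ↦ (k : ℤ)) (fun _ ↦ 0))
    (hΨu : ∀ u : HeightOneSpectrum (𝓞 K), Ψ.IsUnramifiedAt u) :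
    ∃ (M : ℕ) (χ : absoluteGaloisGroup K →ₜ* (PadicAlgCl p)ˣ), 0 < M ∧
      (∀ n : ℕ,
        IsPAdicAvatarOf ι (Ψ ^ (M * n))
          ((FramedRep.unitsContinuousMulEquivOfUnique (Fin 1) (PadicAlgCl p) :
            (PadicAlgCl p)ˣ →ₜ* GL (Fin 1) (PadicAlgCl p)).comp (χ ^ n)) ∧
        FactorsThroughPair κ₁ κ₂
          ((FramedRep.unitsContinuousMulEquivOfUnique (Fin 1) (PadicAlgCl p) :
            (PadicAlgCl p)ˣ →ₜ* GL (Fin 1) (PadicAlgCl p)).comp (χ ^ n))) ∧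
      (∀ (n : ℕ) (σ : absoluteGaloisGroup K),
        ‖avatarValueAt ((FramedRep.unitsContinuousMulEquivOfUnique (Fin 1) (PadicAlgCl p) :
            (PadicAlgCl p)ˣ →ₜ* GL (Fin 1) (PadicAlgCl p)).comp (χ ^ n)) σ - 1‖ < ‖(p : ℂ_[p])‖) ∧
      χ γ₂ = 1 ∧
      ∀ n : ℕ, 0 < n → ∀ σ : absoluteGaloisGroup K, κ₁ σ ≠ 1 → χ σ ^ n ≠ 1 := by
  classical
  have hp : p.Prime := Fact.out
  haveI : IsTotallyComplex K := hK.2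
  have himag : ∀ w : InfinitePlace K, w.IsComplex := fun w ↦ hK.2.isComplex w
  set e := (FramedRep.unitsContinuousMulEquivOfUnique (Fin 1) (PadicAlgCl p) :
    (PadicAlgCl p)ˣ →ₜ* GL (Fin 1) (PadicAlgCl p)) with he
  -- the lead's supply `e ∘ χ₀ⁿ` (avatars of `Ψ^{M₀ n}` through the pair) and a power `N` into the one-units of level `|p|`
  have hΨa : Ψ.IsAlgebraic := (HeckeCharacter.isAlgebraic_iff_exists_hasInfinityType _).mpr ⟨_, _, hΨt⟩
  have hΨu' : ∀ u : HeightOneSpectrum (𝓞 K), ((p : ℕ) : 𝓞 K) ∉ u.asIdeal → Ψ.IsUnramifiedAt u := fun u _ ↦ hΨu u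
  obtain ⟨M₀, χ₀, hM₀, hall⟩ := exists_isPAdicAvatarOf_pow_factorsThroughPair ι hK.1 himag hΨa hΨu' hpair
  obtain ⟨N, hN, hsmallN⟩ := exists_pow_norm_sub_one_lt_norm (p := p) χ₀
  have hall' : ∀ n : ℕ, IsPAdicAvatarOf ι (Ψ ^ (M₀ * N * n)) (e.comp ((χ₀ ^ N) ^ n)) ∧
      FactorsThroughPair κ₁ κ₂ (e.comp ((χ₀ ^ N) ^ n)) := fun n ↦ by
    have h := hall (N * n)
    rw [← mul_assoc, pow_mul χ₀ N n] at h
    exact h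
  -- values of `e ∘ χ₀^{Nn}` are one-units of level `|p|`
  have hnorm1 : ∀ g : absoluteGaloisGroup K, ‖((χ₀ g : (PadicAlgCl p)ˣ) : PadicAlgCl p)‖ = 1 :=
    fun g ↦ norm_apply_eq_one_of_compactSpace χ₀ g
  have hval : ∀ (n : ℕ) (σ : absoluteGaloisGroup K), avatarValueAt (e.comp ((χ₀ ^ N) ^ n)) σ =
      (((((χ₀ σ : (PadicAlgCl p)ˣ) : PadicAlgCl p) ^ N) ^ n : PadicAlgCl p) : ℂ_[p]) := by
    intro n σ
    rw [he, avatarValueAt_unitsChar, ContinuousMonoidHom.pow_apply, ContinuousMonoidHom.pow_apply, Units.val_pow_eq_pow_val,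
      Units.val_pow_eq_pow_val]
  have hsmall : ∀ (n : ℕ) (σ : absoluteGaloisGroup K),
      ‖avatarValueAt (e.comp ((χ₀ ^ N) ^ n)) σ - 1‖ < ‖(p : ℂ_[p])‖ := by
    intro n σ
    set y : PadicAlgCl p := ((χ₀ σ : (PadicAlgCl p)ˣ) : PadicAlgCl p) ^ N with hy
    have hy1 : ‖y‖ ≤ 1 := by rw [hy, norm_pow, hnorm1, one_pow]
    have e1 : avatarValueAt (e.comp ((χ₀ ^ N) ^ n)) σ - 1 = ((y ^ n - 1 : PadicAlgCl p) : ℂ_[p]) := by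
      rw [hval, ← hy, PadicComplex.coe_eq, PadicComplex.coe_eq, map_sub, map_one]
    rw [e1, PadicComplex.norm_extends p, ← PadicComplex.coe_natCast p p, PadicComplex.norm_extends p]
    exact (PadicAlgCl.norm_pow_sub_one_le hy1 n).trans_lt (hsmallN σ)
  -- types and ramification of the powers of `Ψ`
  have htypeΨ : ∀ m : ℕ, (Ψ ^ m).HasInfinityType (fun _ ↦ ((k * m : ℕ) : ℤ)) (fun _ ↦ (0 : ℤ)) := by
    intro m
    have h1 := hΨt.zpow' (m : ℤ)
    rw [zpow_natCast] at h1
    convert h1 using 2 <;> simp only [Pi.smul_apply, smul_eq_mul] <;> push_cast <;> ring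
  have hunrΨ : ∀ (m : ℕ) (u : HeightOneSpectrum (𝓞 K)), (Ψ ^ m).IsUnramifiedAt u :=
    fun m u ↦ isUnramifiedAt_pow' (hΨu u) _
  -- (c) `χ(γ₂) = 1`: the avatar of the type-`(kM, 0)` character `Ψ^M` is unramified at `v̄`
  have hunr1 : FramedGaloisRep.IsUnramifiedAt vbar (e.comp ((χ₀ ^ N) ^ 1)) :=
    isUnramifiedAt_avatar_of_hasInfinityType_zero ι himag hpvbar hne hι (htypeΨ (M₀ * N * 1)) (T := ∅)
      (fun w _ ↦ hunrΨ _ w) (hunrΨ _ vbar) (hall' 1).1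
  have hγ₂ : avatarValueAt (e.comp ((χ₀ ^ N) ^ 1)) γ₂ = 1 :=
    avatarValueAt_eq_one_of_inertia hK hp2 hpvbar hne hpair hur₁ (hall' 1).2 hunr1 (hsmall 1)
  have hχγ₂ : (χ₀ ^ N) γ₂ = 1 := by
    have h := unitsChar_apply_eq_one_of_avatarValueAt_eq_one (by rw [← he]; exact hγ₂)
    rwa [pow_one] at h
  refine ⟨M₀ * N, χ₀ ^ N, Nat.mul_pos hM₀ hN, hall', hsmall, hχγ₂, fun n hn σ hσ hχσ ↦ ?_⟩
  -- (d): `e ∘ χⁿ` kills `σ` and `γ₂`, whose coordinates are independent, so it is trivial, so `Ψ^{Mn} = 1`: type contradiction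
  have e12 : Multiplicative.toAdd (κ₁ γ₂) = 0 := by rw [hpair.apply_right]; rfl
  have e22 : Multiplicative.toAdd (κ₂ γ₂) = 1 := by rw [hpair.right]; rfl
  have hσ1 : avatarValueAt (e.comp ((χ₀ ^ N) ^ n)) σ = 1 := by
    rw [he, avatarValueAt_unitsChar, ContinuousMonoidHom.pow_apply, hχσ, Units.val_one, PadicComplex.coe_eq, map_one]
  have hγ₂n : avatarValueAt (e.comp ((χ₀ ^ N) ^ n)) γ₂ = 1 := by
    rw [he, avatarValueAt_unitsChar, ContinuousMonoidHom.pow_apply, hχγ₂, one_pow, Units.val_one, PadicComplex.coe_eq, map_one]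
  have hσ0 : Multiplicative.toAdd (κ₁ σ) ≠ 0 := fun h0 ↦ hσ (by rw [← ofAdd_toAdd (κ₁ σ), h0, ofAdd_zero])
  have hdet : Multiplicative.toAdd (κ₁ σ) * Multiplicative.toAdd (κ₂ γ₂) -
      Multiplicative.toAdd (κ₂ σ) * Multiplicative.toAdd (κ₁ γ₂) ≠ 0 := by
    rw [e22, e12, mul_one, mul_zero, sub_zero]; exact hσ0
  have htriv : ∀ g, avatarValueAt (e.comp ((χ₀ ^ N) ^ n)) g = 1 :=
    avatarValueAt_eq_one_of_two hpair (hall' n).2 (hsmall n) hσ1 hγ₂n hdet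
  have hχ1 : (χ₀ ^ N) ^ n = 1 := by
    ext g
    have h := unitsChar_apply_eq_one_of_avatarValueAt_eq_one (by rw [← he]; exact htriv g)
    rw [h]; rfl
  have hav1 : IsPAdicAvatarOf ι (Ψ ^ (M₀ * N * n)) (e.comp 1) := by
    rw [← hχ1]; exact (hall' n).1
  have heq : Ψ ^ (M₀ * N * n) = 1 :=
    eq_of_isPAdicAvatarOf_of_isPAdicAvatarOf ι hav1 (isPAdicAvatarOf_one ι) (fun u _ ↦ hunrΨ _ u)
      (fun u _ ↦ isUnramifiedAt_one' u)
  have htyp1 := htypeΨ (M₀ * N * n)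
  rw [heq] at htyp1
  have hne0 : ((k * (M₀ * N * n) : ℕ) : ℤ) ≠ 0 := by
    have : 0 < k * (M₀ * N * n) := Nat.mul_pos hk (Nat.mul_pos (Nat.mul_pos hM₀ hN) hn)
    omega
  exact not_hasInfinityType_one_zero_of_ne_zero hne0 htyp1

end Summit.BirchSwinnertonDyer.BirchSwinnertonDyer.Theorems.UniversalToricDescentThinComb.VerticalCharacter

end
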